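import Summits.NavierStokesRegularity.NavierStokesRegularity.Theorems.ExtremiserTransienceNearExtremalTransienceExtremiserLiouvilleConstantSpeedKKTTailRate
import Summits.NavierStokesRegularity.NavierStokesRegularity.Theorems.ExtremiserTransienceNearExtremalTransienceExtremiserLiouvilleConstantSpeedDecayLiouvilleGeneral
import HarnessLib

/-!
# Crux `ExtremiserTransience.NearExtremalTransience` (stmt-NavierStokesRegularity-21883), line `extremiser_liouville`,
# stub K1b — TAIL DOSSIER (g4): K1b ⟸ «no residue object with a slow, KKT-constrained tail»

`--supports stmt-NavierStokesRegularity-21883` (helper).  Author: prover seat `ns-el-k1b` (g4).  The g4 contribution to the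
dossier chain `…ConstantSpeedDossier` (g2) / `…ConstantSpeedMultiplierDossier` (g3): ONE theorem packaging what this generation
proved about the K1b residue.

`stub_noAnalyticExtremal_of_noTailObject`: K1b (VERBATIM) follows from the non-existence of a field `w` with far field `c` and
speed `M` such that:  `w` is real analytic, `C^∞`, divergence free, `‖Dw‖ ≤ B`, `D¹w, D²w ∈ L²`, `‖w‖ ≡ M = ‖c‖`, `w → c` at
infinity, `M√Z√W > 0`, `|S| = κ⋆M√Z√W` (g2's residue data), AND
  (T1) **slow tail**: for every `a > 1` and `C`, `‖w − c‖ ≤ C(1 + |x|)^{-a}` FAILS somewhere (`…ConstantSpeedDecayLiouvilleGeneral`);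
  (T2) **KKT tail condition**: for every `c`-horizontal solenoidal profile `Φ ∈ C_c^∞(ℝ³ ∖ B_{r₀})`, `r₀ > 0`,
       `∫⟪curl w, curl Φ(·/R)⟫ → 0` as `R → ∞` (`…ConstantSpeedKKTTail`).
So the K1b target for the next seats is: show that (T1) ∧ (T2) (together with g3's multiplier dossier) is inconsistent — e.g. by a
tail expansion in which (T2) (and its rate form `…KKTTailRate`) kills every admissible leading profile.

WHAT THIS IS NOT: K1b is NOT proved; nothing here proves NS regularity. [folklore]
-/

noncomputable section

open Set Filter Topology MeasureTheory Metric Function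
open scoped ENNReal NNReal Topology InnerProductSpace RealInnerProductSpace ContDiff
open Literature.Analysis.FluidPDE Literature.Analysis

namespace Summit.NavierStokesRegularity.NavierStokesRegularity.Theorems

-- the problem directory repeats the summit name (`NavierStokesRegularity/NavierStokesRegularity`)
set_option linter.dupNamespace false

namespace ExtremiserLiouville

/-- **TAIL DOSSIER (g4).**  K1b ⟸ no residue object satisfying (T1) slow tail and (T2) the KKT tail condition. [folklore] -/
theorem stub_noAnalyticExtremal_of_noTailObject
    (hres : ¬ ∃ (w : EuclideanSpace ℝ (Fin 3) → EuclideanSpace ℝ (Fin 3)) (c : EuclideanSpace ℝ (Fin 3)) (M : ℝ),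
      AnalyticOnNhd ℝ w Set.univ ∧ ContDiff ℝ (⊤ : ℕ∞) w ∧ Literature.Analysis.FluidPDE.VectorCalculus.IsDivFree w ∧
      (∃ B : ℝ, ∀ x, ‖fderiv ℝ w x‖ ≤ B) ∧ (∫⁻ x, ‖iteratedFDeriv ℝ 1 w x‖ₑ ^ 2 < ⊤) ∧ (∫⁻ x, ‖iteratedFDeriv ℝ 2 w x‖ₑ ^ 2 < ⊤) ∧
      (∀ x, ‖w x‖ = M) ∧ ‖c‖ = M ∧ Filter.Tendsto (fun x => w x - c) (Filter.cocompact (EuclideanSpace ℝ (Fin 3))) (nhds 0) ∧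
      0 < M * Real.sqrt (∫ x, ‖Literature.Analysis.FluidPDE.curl w x‖ ^ 2) * Real.sqrt (∫ x, Literature.Analysis.FluidPDE.frobeniusNormSq (fderiv ℝ (Literature.Analysis.FluidPDE.curl w) x)) ∧
      |∫ x, ⟪Literature.Analysis.FluidPDE.curl w x, fderiv ℝ w x (Literature.Analysis.FluidPDE.curl w x)⟫_ℝ| = (sInf {κ : ℝ | (∀ (v : EuclideanSpace ℝ (Fin 3) → EuclideanSpace ℝ (Fin 3)) (M B : ℝ), ContDiff ℝ (⊤ : ℕ∞) v → Literature.Analysis.FluidPDE.VectorCalculus.IsDivFree v → (∀ x, ‖v x‖ ≤ M) → (∀ x, ‖fderiv ℝ v x‖ ≤ B) → (∫⁻ x, ‖iteratedFDeriv ℝ 0 v x‖ₑ ^ 2 < ⊤) → (∫⁻ x, ‖iteratedFDeriv ℝ 1 v x‖ₑ ^ 2 < ⊤) → (∫⁻ x, ‖iteratedFDeriv ℝ 2 v x‖ₑ ^ 2 < ⊤) → |∫ x, ⟪Literature.Analysis.FluidPDE.curl v x, fderiv ℝ v x (Literature.Analysis.FluidPDE.curl v x)⟫_ℝ| ≤ κ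 * M * Real.sqrt (∫ x, ‖Literature.Analysis.FluidPDE.curl v x‖ ^ 2) * Real.sqrt (∫ x, Literature.Analysis.FluidPDE.frobeniusNormSq (fderiv ℝ (Literature.Analysis.FluidPDE.curl v) x)))}) * M * Real.sqrt (∫ x, ‖Literature.Analysis.FluidPDE.curl w x‖ ^ 2) * Real.sqrt (∫ x, Literature.Analysis.FluidPDE.frobeniusNormSq (fderiv ℝ (Literature.Analysis.FluidPDE.curl w) x)) ∧
      -- (T1) slow tail: not `O(|x|^{-a})` for any `a > 1`
      (∀ a C₀ : ℝ, 1 < a → ¬ ∀ x, ‖w x - c‖ ≤ C₀ * (1 + ‖x‖) ^ (-a)) ∧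
      -- (T2) the KKT tail condition
      (∀ (Φ : EuclideanSpace ℝ (Fin 3) → EuclideanSpace ℝ (Fin 3)) (r₀ : ℝ), ContDiff ℝ (⊤ : ℕ∞) Φ → HasCompactSupport Φ →
        Literature.Analysis.FluidPDE.VectorCalculus.IsDivFree Φ → 0 < r₀ → (∀ y, ‖y‖ < r₀ → Φ y = 0) → (∀ y, ⟪c, Φ y⟫_ℝ = 0) →
        Filter.Tendsto (fun R : ℝ => ∫ x, ⟪Literature.Analysis.FluidPDE.curl w x,
          Literature.Analysis.FluidPDE.curl (fun y => Φ (R⁻¹ • y)) x⟫_ℝ) Filter.atTop (nhds 0))) :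
    ¬ ∃ (w : EuclideanSpace ℝ (Fin 3) → EuclideanSpace ℝ (Fin 3)), AnalyticOnNhd ℝ w Set.univ ∧ (ContDiff ℝ (⊤ : ℕ∞) w ∧ Literature.Analysis.FluidPDE.VectorCalculus.IsDivFree w ∧ (∃ B : ℝ, ∀ x, ‖fderiv ℝ w x‖ ≤ B) ∧ (∫⁻ x, ‖iteratedFDeriv ℝ 1 w x‖ₑ ^ 2 < ⊤) ∧ (∫⁻ x, ‖iteratedFDeriv ℝ 2 w x‖ₑ ^ 2 < ⊤) ∧ ∃ M : ℝ, (∀ x, ‖w x‖ ≤ M) ∧ 0 < M * Real.sqrt (∫ x, ‖Literature.Analysis.FluidPDE.curl w x‖ ^ 2) * Real.sqrt (∫ x, Literature.Analysis.FluidPDE.frobeniusNormSq (fderiv ℝ (Literature.Analysis.FluidPDE.curl w) x)) ∧ (sInf {κ : ℝ | (∀ (v : EuclideanSpace ℝ (Fin 3) → EuclideanSpace ℝ (Fin 3)) (M B : ℝ), ContDiff ℝ (⊤ : ℕ∞) v → Literature.Analysis.FluidPDE.VectorCalculus.IsDivFree v → (∀ x, ‖v x‖ ≤ M) → (∀ x,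 ‖fderiv ℝ v x‖ ≤ B) → (∫⁻ x, ‖iteratedFDeriv ℝ 0 v x‖ₑ ^ 2 < ⊤) → (∫⁻ x, ‖iteratedFDeriv ℝ 1 v x‖ₑ ^ 2 < ⊤) → (∫⁻ x, ‖iteratedFDeriv ℝ 2 v x‖ₑ ^ 2 < ⊤) → |∫ x, ⟪Literature.Analysis.FluidPDE.curl v x, fderiv ℝ v x (Literature.Analysis.FluidPDE.curl v x)⟫_ℝ| ≤ κ * M * Real.sqrt (∫ x, ‖Literature.Analysis.FluidPDE.curl v x‖ ^ 2) * Real.sqrt (∫ x, Literature.Analysis.FluidPDE.frobeniusNormSq (fderiv ℝ (Literature.Analysis.FluidPDE.curl v) x)))}) * M * Real.sqrt (∫ x, ‖Literature.Analysis.FluidPDE.curl w x‖ ^ 2) * Real.sqrt (∫ x, Literature.Analysis.FluidPDE.frobeniusNormSq (fderiv ℝ (Literature.Analysis.FluidPDE.curl w) x)) ≤ |∫ x, ⟪Literature.Analysis.FluidPDE.curl w x, fderiv ℝ w x (Literature.Analysis.FluidPDE.curl w x)⟫_ℝ|) := by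
  refine stub_noAnalyticExtremal_iff_noConstantSpeedExtremiser.2 ?_
  rintro ⟨w, han, hcd, hdiv, ⟨B, hB⟩, h1, h2, M, hM, hpos, hge⟩
  have hle := extendedSharp w M B hcd hdiv (fun x => (hM x).le) hB h1 h2
  have heq := le_antisymm hge hle
  obtain ⟨c, hcM, hfar, -⟩ :=
    exists_inner_farField_nonpos_of_constSpeed_extremal hcd hdiv hM hB h1 h2 hpos heq.symm
  have hMpos : 0 < M := by
    have hM0 : 0 ≤ M := (norm_nonneg _).trans (hM 0).le
    rcases hM0.lt_or_eq with h | h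
    · exact h
    · rw [← h, zero_mul, zero_mul] at hpos; exact absurd hpos (lt_irrefl 0)
  have hc : c ≠ 0 := by
    intro h0; rw [h0, norm_zero] at hcM; linarith
  refine hres ⟨w, c, M, han, hcd, hdiv, ⟨B, hB⟩, h1, h2, hM, hcM, hfar, hpos, heq.symm, ?_, ?_⟩
  · -- (T1): a fast tail would make `w ≡ c` by the decay-gap Liouville, contradicting `Z > 0`
    intro a C₀ ha hdec
    have hC₀ : 0 ≤ C₀ := by
      have h := hdec 0
      have hp : (0 : ℝ) < (1 + ‖(0 : EuclideanSpace ℝ (Fin 3))‖) ^ (-a) := Real.rpow_pos_of_pos (by positivity) _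
      nlinarith [norm_nonneg (w 0 - c)]
    have hw1 : ContDiff ℝ 1 w := contDiff_infty.1 hcd 1
    have hconst := eq_farField_of_constSpeed_of_decay hw1 hdiv hM hcM hc ha hC₀ hdec
    have hw : w = fun _ => c := funext hconst
    have hcurl : ∀ x, curl w x = 0 := fun x => by
      rw [hw, curl_eq_curlCLM, fderiv_const_apply, map_zero]
    have hZ : (∫ x, ‖curl w x‖ ^ 2) = 0 := by simp [hcurl]
    rw [hZ, Real.sqrt_zero, mul_zero, zero_mul] at hpos
    exact lt_irrefl _ hpos
  · -- (T2): the KKT tail condition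
    intro Φ r₀ hΦ hΦc hΦdiv hr₀ hΦ0 hcΦ
    exact residue_tail_pairing_tendsto_zero hcd hdiv hMpos hM hB h1 h2 hpos heq.symm hfar hΦ hΦc hΦdiv hr₀ hΦ0 hcΦ

end ExtremiserLiouville

end Summit.NavierStokesRegularity.NavierStokesRegularity.Theorems

end
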